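import Summits.CriticalPhenomena.CardyFormulaZ2.Theorems.CardyBoundaryCoulombGasHalfPlaneMarkDensityLawPosFirstHitOfCluster
import Summits.CriticalPhenomena.CardyFormulaZ2.Theorems.CardyBoundaryCoulombGasHalfPlaneMarkDensityLawPosHClusterToolkit

/-!
# `HalfPlaneMarkDensityLaw` (crux stmt-CriticalPhenomena-5661), line `Sketch`:
# stub `stub_nearEnd_of_hCluster` — NearEndPos N4 (deterministic, no planarity)

Let `ω_H = ω ∩ {e | both endpoints of e lie in H}` be the configuration restricted to the edges of the
lattice half-plane `H = ℤ × ℕ` and let `S` be the `ω_H`-cluster of `(k,0)` (the "`H`-cluster"); by the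
toolkit (`Positivity.stub_mem_hCluster_iff`) `z ∈ S ↔ {(k,0) ↔ z in H}`.  Suppose `S` contains a point
`(r,0)` of the source arc `C = [clo,chi] × {0}` and no point `(s,0)` with `alo ≤ s < k`, and that NO open
path of `H` off `S` joins `[alo,k) × {0}` to `C`.  Then `firstHit H C alo k` holds:

* `(r,0) ∈ S` is joined to `(k,0)` inside `H`;
* no `x ∈ C` is joined inside `H` to some `(s,0)`, `alo ≤ s < k`: an open lattice walk `π` of `H` from
  `(s,0)` to `x` avoids `S` — a vertex `z ∈ S` on it would give `(k,0) ↔ z ↔ (s,0)` inside `H`, i.e.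
  `(s,0) ∈ S` — so `π` is an open path of `H` off `S` from `[alo,k) × {0}` to `C`, which is excluded.
-/

noncomputable section

namespace Summit.CriticalPhenomena.CardyFormulaZ2.Cruxes.HalfPlaneMarkDensityLaw.SketchLine

open Literature.Probability.Percolation Literature.Probability.LatticeModels
open MeasureTheory Filter Set SimpleGraph
open scoped Topology
open Summit.CriticalPhenomena.CardyFormulaZ2.Theorems.HalfPlaneMarkDensityLaw.Negative

namespace NearEndPos

/-- STUB N4 (deterministic): if the `H`-cluster of `(k,0)` is `S`, `S` has a bottom point in `[clo,chi]` and none in `[alo,k)`, and no open path of `H` off `S` joins `[alo,k)×{0}` to `[clo,chi]×{0}`, then `firstHit halfPlane ([clo,chi]×{0}) alo k` holds. [folklore] -/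
theorem stub_nearEnd_of_hCluster :
    ∀ (ω : BondConfig (Site 2)) (S : Finset (Site 2)) (k alo clo chi : ℤ), ω ⊆ (zdGraph 2).edgeSet →
      alo ≤ k → k < clo → clo ≤ chi → (∃ r : ℤ, clo ≤ r ∧ r ≤ chi ∧ bpt r ∈ S) → (∀ s : ℤ, alo ≤ s → s < k → bpt s ∉ S) →
      ω ∈ {ω : BondConfig (Site 2) | openCluster (ω ∩ {e : Sym2 (Site 2) | ∀ v ∈ e, v ∈ halfPlane}) (bpt (k)) = ↑S} →
      ω ∉ (⋃ u ∈ rowIco alo k, ⋃ v ∈ rowIcc clo chi,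
          (openConnIn (halfPlane ∩ (↑S : Set (Site 2))ᶜ) u v : Set (BondConfig (Site 2)))) →
      ω ∈ firstHit halfPlane (rowIcc clo chi) alo k := by
  intro ω S k alo clo chi hω _ _ _ hr hnear hcl hno
  rw [Set.mem_setOf_eq] at hcl
  obtain ⟨r, hclor, hrchi, hrS⟩ := hr
  -- membership in the `H`-cluster `S` is "joined to `(k,0)` inside `H`"
  have hS : ∀ z : Site 2, z ∈ S ↔ ω ∈ openConnIn halfPlane (bpt k) z := fun z => by
    have h := Positivity.stub_mem_hCluster_iff ω k z
    rw [hcl, Finset.mem_coe] at h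
    exact h
  refine ⟨⟨bpt r, ?_, bpt k, rfl, ?_⟩, ?_⟩
  · -- `(r,0) ∈ [clo,chi] × {0}`
    obtain ⟨h1, h0⟩ := (site_eq_bpt_iff (bpt r) r).1 rfl
    simp only [rowIcc, Set.mem_setOf_eq, h1, h0, true_and]
    exact ⟨hclor, hrchi⟩
  · -- `(r,0) ↔ (k,0)` inside `H`
    rw [openConnIn_comm]
    exact (hS _).1 hrS
  -- no `x ∈ [clo,chi] × {0}` is joined inside `H` to `[alo,k) × {0}`
  rintro ⟨x, hx, y, hy, hxy⟩
  have hy' : y 1 = 0 ∧ alo ≤ y 0 ∧ y 0 < k := hy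
  -- `y = (y 0, 0) ∉ S`
  have hyS : y ∉ S := by
    have h := hnear (y 0) hy'.2.1 hy'.2.2
    rwa [← (site_eq_bpt_iff y (y 0)).2 ⟨hy'.1, rfl⟩] at h
  rw [openConnIn_comm] at hxy
  -- an open lattice walk of `H` from `y` to `x`
  obtain ⟨π, hπH, hπω⟩ := exists_walk_of_mem_openConnIn hω hxy
  -- `π` avoids `S`: a vertex `z ∈ S` of `π` would give `(k,0) ↔ z ↔ y` inside `H`, i.e. `y ∈ S`
  have hπS : ∀ z ∈ π.support, z ∉ S := fun z hz hzS => by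
    refine hyS ((hS y).2 (PlanarDuality.openConnIn_trans ((hS z).1 hzS) ?_))
    rw [openConnIn_comm]
    exact mem_openConnIn_of_mem_support π hπH hπω hz
  -- hence `π` is an open path of `H` off `S` from `[alo,k) × {0}` to `[clo,chi] × {0}`: excluded
  exact hno (Set.mem_iUnion₂.2 ⟨y, hy, Set.mem_iUnion₂.2 ⟨x, hx,
    mem_openConnIn_of_walk π (fun z hz => ⟨hπH z hz, fun hzS => hπS z hz hzS⟩) hπω⟩⟩)

end NearEndPos

end Summit.CriticalPhenomena.CardyFormulaZ2.Cruxes.HalfPlaneMarkDensityLaw.SketchLine
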